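import Mathlib
import HarnessLib
import Summits.Ventures.LatticeQCDFlow.Scaling.AcceptanceEssEightNinths
import Summits.Ventures.LatticeQCDFlow.Scaling.AcceptanceEssEightNinthsWitness

/-!
# LatticeQCDFlow / Scaling — the acceptance–ESS envelope: `acc ≥ max((8/9)·ESS, 1 − √((1/ESS − 1)/3))`,
# the two pieces cross at `ESS = 3/4` with triple contact (`(4·ESS − 3)³`), and the `8/9` slope is
# traced at every ESS below `3/4` by zero-inflated ramps

HONEST FRAMING: exact (Metropolis-corrected) sampling algorithms for lattice gauge theory;
figures of merit are autocorrelation/cost numbers at stated couplings and volumes; no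
continuum-physics claim.

Venture `LatticeQCDFlow` (cell pub-lqcd), topic `Scaling`; FANOUT row 3 (`s0-u1-a`, S0-B
implementation A, GEN-8).  NEW WORK of the cell (a `max`, a cubic identity and a three-point-family
computation), not a published result; NO definition is introduced.  It assembles row 3's two sharp
floors — `Scaling/AcceptanceGiniFloorSharp` (GEN-6: `(1 − acc)² ≤ (1/ESS − 1)/3`, i.e.
`acc ≥ 1 − √((1/ESS − 1)/3)`) and `Scaling/AcceptanceEssEightNinths` (GEN-8: `acc ≥ (8/9)·ESS`) —
into one statement and records how they fit: in the quantile picture the extremal weight laws are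
the affine ramps (Gini piece, `ESS ≥ 3/4`) and the hinges = zero-inflated ramps (`8/9` piece,
`ESS ≤ 3/4`); the two pieces meet at `ESS = 3/4`, `acc = 2/3` with a PERFECT CUBE as difference.

## Content (finite `X`; target `p ≥ 0`, model `q > 0`, both normalised; `κ = essFrac p q`)

* **`acceptance_envelope`** — `max((8/9)·κ, 1 − √((1/κ − 1)/3)) ≤ acc(p, q)`;
* **`eight_ninths_piece_ge_iff`** — for `0 < κ ≤ 1`:
  `1 − √((1/κ − 1)/3) ≤ (8/9)·κ ↔ κ ≤ 3/4` (because `27(1 − κ) − κ(9 − 8κ)² = −(4κ − 3)³`): the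
  `8/9` piece is the envelope exactly below `ESS = 3/4`, the Gini piece above; because of the triple
  contact the two floors differ by less than `0.002` for `0.65 ≤ ESS ≤ 0.85`, which is why the remark
  "better above `ESS ≈ 0.703`" in the docstring of `Scaling/AcceptanceEssEightNinths` is imprecise —
  the exact crossover is `3/4` (this file's typed statement supersedes that remark);
* **zero-inflated corner ramps** (`Fin (m + 1)`, `m ≥ 1`, `0 ≤ π < 1`: model mass `π` on a point of
  target weight `0`, the corner ramp of `Scaling/AcceptanceEssEightNinthsWitness` on the rest):
  `zeroRamp_sums`, **`zeroRamp_accRate`** — `acc = (1 − π)(2m + 1)/(3m)`, **`zeroRamp_essFrac`** —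
  `ESS = 3(1 − π)(m + 1)/(2(2m + 1))`, hence **`zeroRamp_accRate_eq_mul_essFrac`** —
  `acc = (8/9 + 2/(9m(m + 1)))·ESS` for EVERY `π`: as `π` runs through `[0, 1)` the pair traces the
  whole ray `ESS ∈ (0, 3(m+1)/(2(2m+1))]` at slope `8/9 + 2/(9m(m+1))` — the `8/9` piece of the
  envelope is approached at every `ESS < 3/4`, not only in one corner (mixing in a configuration of
  zero target weight rescales `acc` and `ESS` by the same factor `1 − π`).

The Gini piece is traced at every `ESS ∈ (3/4, 1)` by the slope ramps of row 3's
`Scaling/AcceptanceGiniFloorSlopeWitness` (GEN-8), so both pieces of the envelope are approached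
everywhere by finite pairs.  NOT CLAIMED: attainment on a fixed finite space; the measure-theoretic
version; any number of ours; nothing re-scored.
-/

namespace Summit.Ventures.LatticeQCDFlow.Theory2

open Finset
open Literature.Probability.MarkovChains
open Summit.Ventures.LatticeQCDFlow.Exactness

variable {X : Type*} [Fintype X]

/-! ### The envelope and the crossing -/

/-- **`acc ≥ max((8/9)·ESS, 1 − √((1/ESS − 1)/3))`** for every finite normalised pair
(`p ≥ 0`, `q > 0`). [folklore] -/
theorem acceptance_envelope {p q : X → ℝ} (hp : ∀ x, 0 ≤ p x) (hq : ∀ x, 0 < q x)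
    (hp1 : ∑ x, p x = 1) (hq1 : ∑ x, q x = 1) :
    max (8 / 9 * essFrac p q) (1 - Real.sqrt (((essFrac p q)⁻¹ - 1) / 3)) ≤ accRate p q :=
  max_le (eight_ninths_essFrac_le_accRate hp hq hp1 hq1) (one_sub_sqrt_third_le_accRate hq hp1 hq1)

/-- **The crossing at `ESS = 3/4` is a triple contact.**  For `0 < κ ≤ 1`:
`1 − √((1/κ − 1)/3) ≤ (8/9)·κ ↔ κ ≤ 3/4`; the polynomial form of the comparison is
`27(1 − κ) − κ(9 − 8κ)² = −(4κ − 3)³`. [folklore] -/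
theorem eight_ninths_piece_ge_iff {κ : ℝ} (h0 : 0 < κ) (h1 : κ ≤ 1) :
    1 - Real.sqrt ((κ⁻¹ - 1) / 3) ≤ 8 / 9 * κ ↔ κ ≤ 3 / 4 := by
  have hcube : 27 * (1 - κ) - κ * (9 - 8 * κ) ^ 2 = -(4 * κ - 3) ^ 3 := by ring
  have hx0 : 0 ≤ (κ⁻¹ - 1) / 3 := by
    have : 1 ≤ κ⁻¹ := one_le_inv_iff₀.mpr ⟨h0, h1⟩
    linarith
  have hr0 : 0 ≤ 1 - 8 / 9 * κ := by linarith
  -- `1 − 8κ/9 ≤ √x ↔ (1 − 8κ/9)² ≤ x` since both sides are non-negative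
  have key : 1 - Real.sqrt ((κ⁻¹ - 1) / 3) ≤ 8 / 9 * κ ↔ (1 - 8 / 9 * κ) ^ 2 ≤ (κ⁻¹ - 1) / 3 := by
    constructor
    · intro h
      have h' : 1 - 8 / 9 * κ ≤ Real.sqrt ((κ⁻¹ - 1) / 3) := by linarith
      calc (1 - 8 / 9 * κ) ^ 2 ≤ (Real.sqrt ((κ⁻¹ - 1) / 3)) ^ 2 := pow_le_pow_left₀ hr0 h' 2
        _ = (κ⁻¹ - 1) / 3 := Real.sq_sqrt hx0
    · intro h
      have h' : Real.sqrt ((1 - 8 / 9 * κ) ^ 2) ≤ Real.sqrt ((κ⁻¹ - 1) / 3) := Real.sqrt_le_sqrt h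
      rw [Real.sqrt_sq hr0] at h'
      linarith
  rw [key]
  -- clear the denominator `κ`: `(1 − 8κ/9)² ≤ (1/κ − 1)/3 ↔ κ(9 − 8κ)² ≤ 27(1 − κ)`
  have key2 : (1 - 8 / 9 * κ) ^ 2 ≤ (κ⁻¹ - 1) / 3 ↔ κ * (9 - 8 * κ) ^ 2 ≤ 27 * (1 - κ) := by
    have e1 : (1 - 8 / 9 * κ) ^ 2 = κ * (9 - 8 * κ) ^ 2 / (81 * κ) := by
      field_simp
      ring
    have e2 : (κ⁻¹ - 1) / 3 = 27 * (1 - κ) / (81 * κ) := by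
      field_simp
      ring
    rw [e1, e2, div_le_div_iff_of_pos_right (by positivity)]
  rw [key2]
  constructor
  · intro h
    by_contra hc
    push Not at hc
    have : 0 < (4 * κ - 3) ^ 3 := pow_pos (by linarith) 3
    linarith
  · intro h
    have : (4 * κ - 3) ^ 3 ≤ 0 := by
      have h3 : 4 * κ - 3 ≤ 0 := by linarith
      nlinarith [sq_nonneg (4 * κ - 3)]
    linarith

/-! ### Zero-inflated corner ramps: the `8/9` slope along every ray below `ESS = 3/4` -/

section ZeroRamp

variable {m : ℕ} {π : ℝ}

/-- The zero-inflated corner ramp on `Fin (m + 1)` (`m ≥ 1`, `0 < π < 1`): target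
`p = (0, 2(k+1)/(m(m+1)))_k`, model `q = (π, (1 − π)/m, …, (1 − π)/m)`; normalised, `p ≥ 0`, `q > 0`.
-/
theorem zeroRamp_sums (hm : 1 ≤ m) (hπ0 : 0 < π) (hπ1 : π < 1) :
    (∀ i, 0 ≤ (Fin.cases (0 : ℝ) (fun k : Fin m => 2 * (((k : ℕ) : ℝ) + 1) / (m * (m + 1)))
        : Fin (m + 1) → ℝ) i) ∧
    (∀ i, 0 < (Fin.cases π (fun _ : Fin m => (1 - π) * ((m : ℝ))⁻¹) : Fin (m + 1) → ℝ) i) ∧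
    ∑ i, (Fin.cases (0 : ℝ) (fun k : Fin m => 2 * (((k : ℕ) : ℝ) + 1) / (m * (m + 1)))
        : Fin (m + 1) → ℝ) i = 1 ∧
    ∑ i, (Fin.cases π (fun _ : Fin m => (1 - π) * ((m : ℝ))⁻¹) : Fin (m + 1) → ℝ) i = 1 := by
  have hm0 : (0 : ℝ) < m := by exact_mod_cast (by omega : 0 < m)
  have h1π : 0 < 1 - π := by linarith
  refine ⟨?_, ?_, ?_, ?_⟩
  · intro i
    induction i using Fin.cases with
    | zero => simp
    | succ k => simp only [Fin.cases_succ]; positivity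
  · intro i
    induction i using Fin.cases with
    | zero => simpa using hπ0
    | succ k => simp only [Fin.cases_succ]; positivity
  · rw [Fin.sum_univ_succ]
    simp only [Fin.cases_zero, Fin.cases_succ, zero_add]
    exact cornerRamp_target_sum hm
  · rw [Fin.sum_univ_succ]
    simp only [Fin.cases_zero, Fin.cases_succ]
    rw [← mul_sum, cornerRamp_model_sum hm]
    ring

/-- **Acceptance of the zero-inflated corner ramp**: `acc = (1 − π)(2m + 1)/(3m)` — pairs touching
the zero-weight point never accept, the rest is the corner ramp scaled by `1 − π`. [folklore] -/
theorem zeroRamp_accRate (hm : 1 ≤ m) (hπ0 : 0 < π) (hπ1 : π < 1) :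
    accRate (Fin.cases (0 : ℝ) (fun k : Fin m => 2 * (((k : ℕ) : ℝ) + 1) / (m * (m + 1)))
        : Fin (m + 1) → ℝ)
      (Fin.cases π (fun _ : Fin m => (1 - π) * ((m : ℝ))⁻¹) : Fin (m + 1) → ℝ)
      = (1 - π) * ((2 * (m : ℝ) + 1) / (3 * m)) := by
  have hm0 : (0 : ℝ) < m := by exact_mod_cast (by omega : 0 < m)
  have h1π : 0 ≤ 1 - π := by linarith
  have hram : ∀ k : Fin m, 0 ≤ 2 * (((k : ℕ) : ℝ) + 1) / (m * (m + 1)) := fun k => by positivity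
  rw [← cornerRamp_accRate hm]
  unfold accRate
  rw [Fin.sum_univ_succ]
  simp only [Fin.cases_zero, Fin.cases_succ, zero_mul]
  -- the row `i = 0` vanishes
  have hrow : ∑ j : Fin (m + 1), min (0 : ℝ)
      ((Fin.cases (0 : ℝ) (fun k : Fin m => 2 * (((k : ℕ) : ℝ) + 1) / (m * (m + 1)))
        : Fin (m + 1) → ℝ) j * π) = 0 := by
    refine sum_eq_zero fun j _ => min_eq_left ?_
    induction j using Fin.cases with
    | zero => simp
    | succ k => simp only [Fin.cases_succ]; exact mul_nonneg (hram k) hπ0.le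
  rw [hrow, zero_add]
  -- in every other row the column `j = 0` vanishes and the rest factorises `(1 − π)`
  rw [mul_sum]
  refine sum_congr rfl fun k _ => ?_
  rw [Fin.sum_univ_succ]
  simp only [Fin.cases_zero, Fin.cases_succ, zero_mul]
  rw [min_eq_right (mul_nonneg (hram k) hπ0.le), zero_add, mul_sum]
  refine sum_congr rfl fun l _ => ?_
  have e : ∀ a b : Fin m, 2 * (((a : ℕ) : ℝ) + 1) / (m * (m + 1)) * ((1 - π) * ((m : ℝ))⁻¹)
      = (1 - π) * (2 * (((a : ℕ) : ℝ) + 1) / (m * (m + 1)) * ((m : ℝ))⁻¹) := fun a b => by ring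
  rw [e k l, e l k, mul_min_of_nonneg _ _ h1π]

/-- **ESS of the zero-inflated corner ramp**: `ESS = 3(1 − π)(m + 1)/(2(2m + 1))`. [folklore] -/
theorem zeroRamp_essFrac (hm : 1 ≤ m) (hπ0 : 0 < π) (hπ1 : π < 1) :
    essFrac (Fin.cases (0 : ℝ) (fun k : Fin m => 2 * (((k : ℕ) : ℝ) + 1) / (m * (m + 1)))
        : Fin (m + 1) → ℝ)
      (Fin.cases π (fun _ : Fin m => (1 - π) * ((m : ℝ))⁻¹) : Fin (m + 1) → ℝ)
      = 3 * (1 - π) * ((m : ℝ) + 1) / (2 * (2 * m + 1)) := by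
  have hm0 : (0 : ℝ) < m := by exact_mod_cast (by omega : 0 < m)
  have hmne : (m : ℝ) ≠ 0 := hm0.ne'
  have h1π : 0 < 1 - π := by linarith
  obtain ⟨-, hq, hp1, -⟩ := zeroRamp_sums hm hπ0 hπ1
  have h := sum_mul_weight_sq_eq_inv_essFrac hq hp1
  rw [Fin.sum_univ_succ] at h
  simp only [Fin.cases_zero, Fin.cases_succ, weight, zero_div] at h
  have hsum : ∑ k : Fin m, (1 - π) * ((m : ℝ))⁻¹
      * (2 * (((k : ℕ) : ℝ) + 1) / (m * (m + 1)) / ((1 - π) * ((m : ℝ))⁻¹)) ^ 2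
      = 2 * (2 * (m : ℝ) + 1) / (3 * (1 - π) * (m + 1)) := by
    have e : ∀ k : Fin m, (1 - π) * ((m : ℝ))⁻¹
        * (2 * (((k : ℕ) : ℝ) + 1) / (m * (m + 1)) / ((1 - π) * ((m : ℝ))⁻¹)) ^ 2
        = (4 / ((1 - π) * m * (m + 1) ^ 2)) * (((k : ℕ) : ℝ) + 1) ^ 2 := by
      intro k
      field_simp
      ring
    simp_rw [e]
    rw [← mul_sum, Fin.sum_univ_eq_sum_range (fun k => ((k : ℝ) + 1) ^ 2) m, sum_range_succ_sq_real]
    field_simp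
    ring
  rw [hsum] at h
  have h2 : (essFrac (Fin.cases (0 : ℝ) (fun k : Fin m => 2 * (((k : ℕ) : ℝ) + 1) / (m * (m + 1)))
        : Fin (m + 1) → ℝ)
      (Fin.cases π (fun _ : Fin m => (1 - π) * ((m : ℝ))⁻¹) : Fin (m + 1) → ℝ))⁻¹
      = 2 * (2 * (m : ℝ) + 1) / (3 * (1 - π) * (m + 1)) := by
    rw [← h]
    simp
  have := congrArg (·⁻¹) h2
  simp only [inv_inv, inv_div] at this
  rw [this]

/-- **The `8/9` slope at every ESS below `3/4`.**  For every `m ≥ 1` and `0 < π < 1` the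
zero-inflated corner ramp has `acc = (8/9 + 2/(9m(m + 1)))·ESS` exactly, while its ESS
`3(1 − π)(m + 1)/(2(2m + 1))` sweeps `(0, 3(m+1)/(2(2m+1)))` as `π` varies. [folklore] -/
theorem zeroRamp_accRate_eq_mul_essFrac (hm : 1 ≤ m) (hπ0 : 0 < π) (hπ1 : π < 1) :
    accRate (Fin.cases (0 : ℝ) (fun k : Fin m => 2 * (((k : ℕ) : ℝ) + 1) / (m * (m + 1)))
        : Fin (m + 1) → ℝ)
      (Fin.cases π (fun _ : Fin m => (1 - π) * ((m : ℝ))⁻¹) : Fin (m + 1) → ℝ)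
      = (8 / 9 + 2 / (9 * (m : ℝ) * (m + 1)))
        * essFrac (Fin.cases (0 : ℝ) (fun k : Fin m => 2 * (((k : ℕ) : ℝ) + 1) / (m * (m + 1)))
            : Fin (m + 1) → ℝ)
          (Fin.cases π (fun _ : Fin m => (1 - π) * ((m : ℝ))⁻¹) : Fin (m + 1) → ℝ) := by
  have hm0 : (0 : ℝ) < m := by exact_mod_cast (by omega : 0 < m)
  have h1π : 0 < 1 - π := by linarith
  rw [zeroRamp_accRate hm hπ0 hπ1, zeroRamp_essFrac hm hπ0 hπ1]
  field_simp
  ring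

end ZeroRamp

end Summit.Ventures.LatticeQCDFlow.Theory2
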